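import Literature.Combinatorics.Designs.GolayPairs

/-!
# Hadamard 668 census — the Golay sub-route of the base-sequence family at `v = 167` is closed (kernel)

Framing: lottery ticket; floor = certified bounds/negative ranges.

Cell pub-namedobj (venture DiscreteObjects), target (H).  Base sequences `BS(m+1, m+1, m, m)` are known for every
Golay number `m` through `({1, X}, {1, -X}, Y, Y)`, `(X, Y)` a Golay pair of length `m` (Seberry–Yamada 2020 §5.9;
kernel: `golay_baseSeq`).  At `668 = 4·167` the relevant split is `BS(84, 84, 83, 83)`, i.e. `m = 83`; but a Golay
pair of length `83 ≡ 3 (mod 4)` cannot exist (`golay_length_mod_four`: the element sums would satisfy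
`x² + y² = 166 ≡ 6 (mod 8)` with `x, y` odd) — the `n ≡ 3 (mod 4)` case of the classical "Golay numbers are even"
(SY 2020 Lemma 1.23).  So:
* `no_golayPair_83` — there is no Golay pair of length `83`;
* `golay_route_668_vacuous` — the Golay sub-route to `BS(84, 84, 83, 83)` (hence to `H(668)` through
  `TurynTypeFamily668.hadamard668_of_baseSeq_84_83`) has no input.
This closes ONE sub-route in the kernel; `BS(84, 84, 83, 83)` itself (Đoković's conjecture `BS(n+1, n)` at `n = 83`),
`TT(56)` and T-sequences of length `167` remain OPEN; no order is excluded; H(668) untouched; HITS 0.  No `sorry`.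
-/

namespace Summit.Ventures.DiscreteObjects.Hadamard

open Literature.Combinatorics.Designs.TSequences
open Literature.Combinatorics.Designs.BaseSequences
open Literature.Combinatorics.Designs.GolayPairs

/-- **no Golay pair of length 83** (`83 ≡ 3 (mod 4)`; mod-8 obstruction on the element sums). -/
theorem no_golayPair_83 : ¬ ∃ a b : ℕ → ℤ, IsGolayPair 83 a b :=
  no_golayPair_of_mod_four (by norm_num)

/-- for the record, the positive construction the sub-route would use: a Golay pair of length `83` WOULD give
`BS(84, 84, 83, 83)` (SY 2020 §5.9, kernel `golay_baseSeq` at `m = 83`; `1 + 83 = 84`). -/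
theorem golay83_would_give_baseSeq_84_83 {a b : ℕ → ℤ} (h : IsGolayPair 83 a b) :
    IsBaseSeq 84 83 (cat 1 (fun _ => 1) a) (cat 1 (fun _ => 1) fun i => -a i) b b :=
  golay_baseSeq h

/-- **the Golay sub-route to H(668) is vacuous**: the set of Golay pairs of length `83` — the only Golay input producing
base sequences with `m + n = 167` through `BS(m+1, m+1, m, m)` (`2m + 1 = 167 ⇔ m = 83`) — is empty, so every
statement quantified over it holds trivially; in particular nothing about H(668) follows from this sub-route. -/
theorem golay_route_668_vacuous (P : (ℕ → ℤ) → (ℕ → ℤ) → Prop) :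
    ∀ a b : ℕ → ℤ, IsGolayPair 83 a b → P a b :=
  fun a b h => absurd ⟨a, b, h⟩ no_golayPair_83

/-- the arithmetic behind `m = 83`: `2m + 1 = 167` has the unique solution `m = 83`, and `83 % 4 = 3`. -/
theorem golay_route_668_parameters (m : ℕ) : (m + 1) + m = 167 ↔ m = 83 := by
  omega

end Summit.Ventures.DiscreteObjects.Hadamard
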